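import Mathlib
import HarnessLib
import Summits.HubbardSuperconductivity.HubbardSuperconductivity.Theorems.KLProgrammeKLRegimeTwoVolumeTowerBaseSrcBlockRows

/-!
# Route `KLProgramme` — crux K3, VL child `KLRegimeVolumeLimitV17F2` (stmt-HubbardSuperconductivity-20440), base of the two-volume tower:
# WEIGHTED HALF-RANGE CHARACTER SUMS ON THE `4M` TIME TORUS — the `ℓ¹` norm of `d ↦ Σ_{j<2M} w_j χ_j(d)` from the sup and the SECOND DIFFERENCES
# of the weights (Abel summation twice; part 1 of lemma (α) of the window key «(VL)-SRC-WINDOW» for atom HB1, pen (R225) / registrant k3c4-p1 g16;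
# cell gate-hubbard-kl, seat p3 g18; `--supports` 20440)

The plain source block of the tower's base (multiplier `trivialMultiplier ≡ 1` on the `2M` Matsubara indices) is the half-range Dirichlet kernel on the
`4M` time grid, with rows `≍ (2/π) ln M` (`…TowerBaseSrcBlockRows`).  A weight sequence `w_j` that vanishes at `j = 0` and for `j ≥ 2M` and has SMALL
SECOND DIFFERENCES has an `M`-uniformly summable character sum instead:

* §1 Abel summation twice: `(1 − x)²·Σ_{m<K} w_m x^m = Σ_{m<K+2} (w_m − 2w_{m−1} + w_{m−2}) x^m` for weights vanishing at `m = 0`, `K`, `K+1`, hence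
  `‖1 − x‖²·‖Σ_{m<K} w_m x^m‖ ≤ Σ_{m<K+2} ‖Δ²w_m‖` on the closed unit disc;
* §2 the nontrivial `4M`-th roots of unity: `‖1 − e^{2πi v/4M}‖ = 2 sin(πv/4M) ≥ u/M` for `u ∈ {v, 4M − v}` with `2u ≤ 4M` (Jordan's inequality);
* §3 **`sum_norm_weightedCharSum_le`** — `(1/2M)·Σ_{d ∈ ℤ/4M} ‖Σ_{j<2M} w_j χ_j(d)‖ ≤ s₀ + 4M(M+1)·v₂` whenever `‖w_j‖ ≤ s₀` and
  `‖w_j − 2w_{j−1} + w_{j−2}‖ ≤ v₂` for all `j` (truncated subtraction); for a smooth window `w_j = χ(x_j)` with grid step `≍ 1/M` one has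
  `v₂ = O(M⁻²)`, so the bound is `O(1)` — used in `…TowerBaseSrcWindowRows`.

Proofs only; no definition.  Honest framing: finite Fourier bookkeeping; nothing here asserts any stub of 20440, K3, VL or superconductivity.
[cite: BenfattoGiulianiMastropietro2006, §2.7 (2.70)–(2.71a)]
-/

noncomputable section

namespace Summit.HubbardSuperconductivity.HubbardSuperconductivity.Theorems.TwoVolumeSource

set_option linter.dupNamespace false -- summit = problem name (single-conjunct summit), D-0017

open Finset Complex Literature.MathematicalPhysics.QuantumLattice GrassmannAlgebra Literature.Probability.LatticeModels
open Summit.HubbardSuperconductivity.HubbardSuperconductivity.Theorems.KLProgrammeLegKernels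
open Summit.HubbardSuperconductivity.HubbardSuperconductivity.Theorems.KLRegimeSplit
open Summit.HubbardSuperconductivity.HubbardSuperconductivity.Theorems.EngineV8
open Summit.HubbardSuperconductivity.HubbardSuperconductivity.Theorems.TwoVolumeDefect
open scoped ComplexConjugate Real

/-! ## §1 Abel summation twice -/

/-- **Abel summation once**: for weights vanishing at `0` and at `K`, `(1 − x)·Σ_{m<K} w_m x^m = Σ_{m<K+1} (w_m − w_{m−1}) x^m`
(truncated subtraction: `w_{0−1} = w_0 = 0`). [folklore] -/
theorem one_sub_mul_weightedGeom (w : ℕ → ℂ) (hw0 : w 0 = 0) {K : ℕ} (hK : w K = 0) (x : ℂ) :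
    (1 - x) * ∑ m ∈ Finset.range K, w m * x ^ m = ∑ m ∈ Finset.range (K + 1), (w m - w (m - 1)) * x ^ m := by
  have h1 : ∑ m ∈ Finset.range (K + 1), w m * x ^ m = ∑ m ∈ Finset.range K, w m * x ^ m := by
    rw [Finset.sum_range_succ, hK, zero_mul, add_zero]
  have h2 : ∑ m ∈ Finset.range (K + 1), w (m - 1) * x ^ m = ∑ m ∈ Finset.range K, w m * x ^ (m + 1) := by
    rw [Finset.sum_range_succ']
    simp only [Nat.add_sub_cancel, Nat.zero_sub, hw0, zero_mul, add_zero]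
  calc (1 - x) * ∑ m ∈ Finset.range K, w m * x ^ m
      = ∑ m ∈ Finset.range K, w m * x ^ m - ∑ m ∈ Finset.range K, w m * x ^ (m + 1) := by
        rw [sub_mul, one_mul, Finset.mul_sum, ← Finset.sum_sub_distrib, ← Finset.sum_sub_distrib]
        exact Finset.sum_congr rfl fun m _ => by ring
    _ = ∑ m ∈ Finset.range (K + 1), (w m - w (m - 1)) * x ^ m := by
        rw [← h1, ← h2, ← Finset.sum_sub_distrib]
        exact Finset.sum_congr rfl fun m _ => by ring

/-- **Abel summation twice**: for weights vanishing at `0`, `K` and `K + 1`,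
`(1 − x)²·Σ_{m<K} w_m x^m = Σ_{m<K+2} (w_m − 2w_{m−1} + w_{m−2}) x^m`. [folklore] -/
theorem one_sub_sq_mul_weightedGeom (w : ℕ → ℂ) (hw0 : w 0 = 0) {K : ℕ} (hK : w K = 0) (hK1 : w (K + 1) = 0) (x : ℂ) :
    (1 - x) ^ 2 * ∑ m ∈ Finset.range K, w m * x ^ m =
      ∑ m ∈ Finset.range (K + 2), (w m - 2 * w (m - 1) + w (m - 2)) * x ^ m := by
  have hd0 : (fun m => w m - w (m - 1)) 0 = 0 := by simp
  have hdK : (fun m => w m - w (m - 1)) (K + 1) = 0 := by simp [hK, hK1]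
  have h1 := one_sub_mul_weightedGeom w hw0 hK x
  have h2 := one_sub_mul_weightedGeom (fun m => w m - w (m - 1)) hd0 hdK x
  calc (1 - x) ^ 2 * ∑ m ∈ Finset.range K, w m * x ^ m = (1 - x) * ((1 - x) * ∑ m ∈ Finset.range K, w m * x ^ m) := by ring
    _ = (1 - x) * ∑ m ∈ Finset.range (K + 1), (w m - w (m - 1)) * x ^ m := by rw [h1]
    _ = ∑ m ∈ Finset.range (K + 1 + 1), ((w m - w (m - 1)) - (w (m - 1) - w (m - 1 - 1))) * x ^ m := h2
    _ = ∑ m ∈ Finset.range (K + 2), (w m - 2 * w (m - 1) + w (m - 2)) * x ^ m := by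
        rw [show K + 1 + 1 = K + 2 from rfl]
        refine Finset.sum_congr rfl fun m _ => ?_
        rw [show m - 1 - 1 = m - 2 by omega]
        ring

/-- **The weighted geometric sum against `(1 − x)²` on the closed unit disc**:
`‖1 − x‖²·‖Σ_{m<K} w_m x^m‖ ≤ Σ_{m<K+2} ‖w_m − 2w_{m−1} + w_{m−2}‖`. [folklore] -/
theorem norm_one_sub_sq_mul_weightedGeom_le (w : ℕ → ℂ) (hw0 : w 0 = 0) {K : ℕ} (hK : w K = 0) (hK1 : w (K + 1) = 0) {x : ℂ}
    (hx : ‖x‖ ≤ 1) :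
    ‖1 - x‖ ^ 2 * ‖∑ m ∈ Finset.range K, w m * x ^ m‖ ≤ ∑ m ∈ Finset.range (K + 2), ‖w m - 2 * w (m - 1) + w (m - 2)‖ := by
  rw [← norm_pow, ← norm_mul, one_sub_sq_mul_weightedGeom w hw0 hK hK1 x]
  refine (norm_sum_le _ _).trans (Finset.sum_le_sum fun m _ => ?_)
  rw [norm_mul, norm_pow]
  exact mul_le_of_le_one_right (norm_nonneg _) (pow_le_one₀ (norm_nonneg _) hx)

/-! ## §2 The nontrivial `4M`-th roots of unity -/

/-- Jordan's inequality on the grid: for `2u ≤ 4M`, `u/M ≤ 2·sin(π u/4M)` (and the sine is nonnegative). [folklore] -/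
theorem div_le_two_mul_sin_grid (M : ℕ) [NeZero M] {u : ℕ} (hu : 2 * u ≤ 2 * (2 * M)) :
    (u : ℝ) / M ≤ 2 * Real.sin (π * u / (2 * (2 * M) : ℕ)) := by
  have hM0 : (0 : ℝ) < M := Nat.cast_pos.2 (Nat.pos_of_ne_zero (NeZero.ne M))
  have hπ := Real.pi_pos
  have hN0 : (0 : ℝ) < ((2 * (2 * M) : ℕ) : ℝ) := Nat.cast_pos.2 (by have := NeZero.ne M; omega)
  have hx0 : 0 ≤ π * u / (2 * (2 * M) : ℕ) := by positivity
  have hx1 : π * u / (2 * (2 * M) : ℕ) ≤ π / 2 := by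
    rw [div_le_div_iff₀ hN0 two_pos]
    have h : (2 * u : ℝ) ≤ ((2 * (2 * M) : ℕ) : ℝ) := by exact_mod_cast hu
    nlinarith
  have hj := Real.mul_le_sin hx0 hx1
  have hid : 2 / π * (π * u / (2 * (2 * M) : ℕ)) = (u : ℝ) / (2 * M) := by
    push_cast
    field_simp
  rw [hid] at hj
  have h2 : (u : ℝ) / M = 2 * ((u : ℝ) / (2 * M)) := by
    field_simp
  rw [h2]
  linarith

/-- **The distance from `1` of a nontrivial `4M`-th root of unity**: for `1 ≤ v < 4M`, `‖1 − e^{2πi v/4M}‖ = 2 sin(π v/4M) ≥ v/M` if `2v ≤ 4M` and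
`≥ (4M − v)/M` if `4M ≤ 2v`. [folklore] -/
theorem norm_one_sub_rootOfUnity_ge (M : ℕ) [NeZero M] {v : ℕ} (hvN : v < 2 * (2 * M)) :
    (2 * v ≤ 2 * (2 * M) → (v : ℝ) / M ≤ ‖(1 : ℂ) - Complex.exp (2 * π * I * v / (2 * (2 * M) : ℕ))‖) ∧
    (2 * (2 * M) ≤ 2 * v → ((2 * (2 * M) - v : ℕ) : ℝ) / M ≤ ‖(1 : ℂ) - Complex.exp (2 * π * I * v / (2 * (2 * M) : ℕ))‖) := by
  have hπ := Real.pi_pos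
  set N : ℕ := 2 * (2 * M) with hN
  have hN0 : (0 : ℝ) < (N : ℝ) := by rw [hN]; have := NeZero.ne M; positivity
  have hθ : Complex.exp (2 * π * I * v / (N : ℕ)) = Complex.exp (I * ((2 * π * v / N : ℝ) : ℂ)) := by
    congr 1
    push_cast
    ring
  have hnorm : ‖(1 : ℂ) - Complex.exp (2 * π * I * v / (N : ℕ))‖ = 2 * Real.sin (π * v / N) := by
    rw [norm_sub_rev, hθ, Complex.norm_exp_I_mul_ofReal_sub_one]
    have hhalf : (2 * π * v / N : ℝ) / 2 = π * v / N := by ring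
    rw [hhalf, Real.norm_eq_abs, abs_of_nonneg]
    refine mul_nonneg zero_le_two (Real.sin_nonneg_of_nonneg_of_le_pi (by positivity) ?_)
    rw [div_le_iff₀ hN0]
    have h : (v : ℝ) ≤ N := by exact_mod_cast hvN.le
    nlinarith
  refine ⟨fun h => ?_, fun h => ?_⟩
  · rw [hnorm]
    exact div_le_two_mul_sin_grid M h
  · rw [hnorm]
    have hrefl : Real.sin (π * v / N) = Real.sin (π * ((N - v : ℕ) : ℝ) / (2 * (2 * M) : ℕ)) := by
      rw [← Real.sin_pi_sub, ← hN, Nat.cast_sub hvN.le]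
      congr 1
      field_simp
    rw [hrefl]
    exact div_le_two_mul_sin_grid M (u := N - v) (by omega)

/-! ## §3 The weighted character sums over the whole time torus -/

/-- The weighted half-range character sum at a natural representative is a weighted geometric sum. [folklore] -/
theorem weightedCharSum_eq_geom (M : ℕ) [NeZero M] (w : ℕ → ℂ) (v : ℕ) :
    ∑ j : Fin (2 * M), w j * torusChar (fun _ : Fin 1 => ((j : ℕ) : ZMod (2 * (2 * M)))) (fun _ : Fin 1 => ((v : ℕ) : ZMod (2 * (2 * M)))) =
      ∑ m ∈ Finset.range (2 * M), w m * Complex.exp (2 * π * I * v / (2 * (2 * M) : ℕ)) ^ m := by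
  simp_rw [torusChar_natCast_one]
  exact Fin.sum_univ_eq_sum_range (fun m => w m * Complex.exp (2 * π * I * v / (2 * (2 * M) : ℕ)) ^ m) (2 * M)

/-- **Pointwise bound at a nonzero time difference**: for `1 ≤ v < 4M` and weights vanishing at `0` and beyond `2M` with
`Σ_{m<2M+2} ‖w_m − 2w_{m−1} + w_{m−2}‖ ≤ V₂`, `‖Σ_{j<2M} w_j χ_j(v)‖ ≤ V₂·M²·(1/v² + 1/(4M − v)²)`. [folklore] -/
theorem norm_weightedCharSum_le_of_ne_zero (M : ℕ) [NeZero M] (w : ℕ → ℂ) (hw0 : w 0 = 0) (hw2M : ∀ m, 2 * M ≤ m → w m = 0)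
    {V₂ : ℝ} (hV : ∑ m ∈ Finset.range (2 * M + 2), ‖w m - 2 * w (m - 1) + w (m - 2)‖ ≤ V₂) {v : ℕ} (hv1 : 1 ≤ v) (hvN : v < 2 * (2 * M)) :
    ‖∑ j : Fin (2 * M), w j * torusChar (fun _ : Fin 1 => ((j : ℕ) : ZMod (2 * (2 * M)))) (fun _ : Fin 1 => ((v : ℕ) : ZMod (2 * (2 * M))))‖ ≤
      V₂ * (M : ℝ) ^ 2 * ((((v : ℕ) : ℝ) ^ 2)⁻¹ + (((2 * (2 * M) - v : ℕ) : ℝ) ^ 2)⁻¹) := by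
  have hM0 : (0 : ℝ) < M := Nat.cast_pos.2 (Nat.pos_of_ne_zero (NeZero.ne M))
  rw [weightedCharSum_eq_geom]
  set x : ℂ := Complex.exp (2 * π * I * v / (2 * (2 * M) : ℕ)) with hx
  set S : ℂ := ∑ m ∈ Finset.range (2 * M), w m * x ^ m with hS
  have hx1 : ‖x‖ ≤ 1 := by
    have hθ : x = Complex.exp (((2 * π * v / (2 * (2 * M) : ℕ) : ℝ) : ℂ) * I) := by
      rw [hx]
      congr 1
      push_cast
      ring
    rw [hθ, Complex.norm_exp_ofReal_mul_I]
  -- Abel twice: `‖1 − x‖²·‖S‖ ≤ V₂`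
  have hAbel : ‖1 - x‖ ^ 2 * ‖S‖ ≤ V₂ :=
    (norm_one_sub_sq_mul_weightedGeom_le w hw0 (hw2M (2 * M) le_rfl) (hw2M (2 * M + 1) (by omega)) hx1).trans hV
  -- from a lower bound `0 < a ≤ ‖1 − x‖`: `‖S‖ ≤ V₂/a²`
  have hkey : ∀ a : ℝ, 0 < a → a ≤ ‖1 - x‖ → ‖S‖ ≤ V₂ / a ^ 2 := fun a ha hle => by
    rw [le_div_iff₀ (by positivity)]
    calc ‖S‖ * a ^ 2 ≤ ‖S‖ * ‖1 - x‖ ^ 2 := mul_le_mul_of_nonneg_left (pow_le_pow_left₀ ha.le hle 2) (norm_nonneg _)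
      _ ≤ V₂ := by rw [mul_comm]; exact hAbel
  have hroot := norm_one_sub_rootOfUnity_ge M hvN
  have hv0 : (0 : ℝ) < v := Nat.cast_pos.2 (by omega)
  have hNv0 : (0 : ℝ) < ((2 * (2 * M) - v : ℕ) : ℝ) := Nat.cast_pos.2 (by omega)
  have hV0 : 0 ≤ V₂ := le_trans (Finset.sum_nonneg fun m _ => norm_nonneg _) hV
  have hA : 0 ≤ V₂ * (M : ℝ) ^ 2 * (((v : ℕ) : ℝ) ^ 2)⁻¹ := by positivity
  have hB : 0 ≤ V₂ * (M : ℝ) ^ 2 * ((((2 * (2 * M) - v : ℕ) : ℝ)) ^ 2)⁻¹ := by positivity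
  rcases le_or_gt (2 * v) (2 * (2 * M)) with h | h
  · have h1 := hkey ((v : ℝ) / M) (by positivity) (hroot.1 h)
    have hid : V₂ / ((v : ℝ) / M) ^ 2 = V₂ * (M : ℝ) ^ 2 * (((v : ℕ) : ℝ) ^ 2)⁻¹ := by
      field_simp
    rw [hid] at h1
    calc ‖S‖ ≤ _ := h1
      _ ≤ _ := by rw [mul_add]; exact le_add_of_nonneg_right hB
  · have h1 := hkey (((2 * (2 * M) - v : ℕ) : ℝ) / M) (by positivity) (hroot.2 h.le)
    have hid : V₂ / ((((2 * (2 * M) - v : ℕ) : ℝ)) / M) ^ 2 = V₂ * (M : ℝ) ^ 2 * ((((2 * (2 * M) - v : ℕ) : ℝ)) ^ 2)⁻¹ := by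
      field_simp
    rw [hid] at h1
    calc ‖S‖ ≤ _ := h1
      _ ≤ _ := by rw [mul_add]; exact le_add_of_nonneg_left hA

/-- **THE WEIGHTED CHARACTER SUMS OVER THE WHOLE TIME TORUS**: for weights `w` on the Matsubara indices vanishing at `j = 0` and for `j ≥ 2M`,
with `‖w_j‖ ≤ s₀` and second differences `‖w_j − 2w_{j−1} + w_{j−2}‖ ≤ v₂` (all `j`, truncated subtraction),
`(1/2M)·Σ_{d ∈ ℤ/4M} ‖Σ_{j<2M} w_j χ_j(d)‖ ≤ s₀ + 4M(M+1)·v₂` (zero difference: `2M·s₀`; the others by §1–§2 and `Σ_{v≥1} v⁻² ≤ 2`). [folklore] -/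
theorem sum_norm_weightedCharSum_le (M : ℕ) [NeZero M] (w : ℕ → ℂ) (hw0 : w 0 = 0) (hw2M : ∀ m, 2 * M ≤ m → w m = 0) {s₀ v₂ : ℝ}
    (hs : ∀ m, ‖w m‖ ≤ s₀) (hv : ∀ m, ‖w m - 2 * w (m - 1) + w (m - 2)‖ ≤ v₂) :
    1 / (2 * (M : ℝ)) * ∑ d : TorusSite 1 (2 * (2 * M)),
        ‖∑ j : Fin (2 * M), w j * torusChar (fun _ : Fin 1 => ((j : ℕ) : ZMod (2 * (2 * M)))) d‖ ≤ s₀ + 4 * M * (M + 1) * v₂ := by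
  classical
  have hM0 : (0 : ℝ) < M := Nat.cast_pos.2 (Nat.pos_of_ne_zero (NeZero.ne M))
  set N : ℕ := 2 * (2 * M) with hN
  have hNpos : 0 < N := by rw [hN]; have := NeZero.ne M; omega
  set h : ZMod N → ℝ := fun a => ‖∑ j : Fin (2 * M), w j * torusChar (fun _ : Fin 1 => ((j : ℕ) : ZMod N)) (fun _ : Fin 1 => a)‖ with hh
  -- (i) the sum over `TorusSite 1 N = Fin 1 → ZMod N` is the sum over `ZMod N`, i.e. over the representatives `v < N`
  have hequiv : ∑ d : TorusSite 1 N, ‖∑ j : Fin (2 * M), w j * torusChar (fun _ : Fin 1 => ((j : ℕ) : ZMod N)) d‖ = ∑ a : ZMod N, h a := by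
    refine Fintype.sum_equiv (Equiv.funUnique (Fin 1) (ZMod N)) _ _ fun d => ?_
    have hd : (fun _ : Fin 1 => d default) = d := by
      funext i
      rw [Fin.eq_zero i]
      rfl
    simp only [hh, Equiv.funUnique_apply, hd]
  have hbij : Function.Bijective (fun i : Fin N => ((i : ℕ) : ZMod N)) := by
    rw [Fintype.bijective_iff_injective_and_card]
    refine ⟨fun i i' hii' => ?_, by simp [ZMod.card]⟩
    have hval := congr_arg ZMod.val hii'
    simp only [ZMod.val_cast_of_lt i.isLt, ZMod.val_cast_of_lt i'.isLt] at hval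
    exact Fin.ext hval
  have hrange : ∑ a : ZMod N, h a = ∑ v ∈ Finset.range N, h ((v : ℕ) : ZMod N) := by
    rw [← Fintype.sum_bijective _ hbij (fun i : Fin N => h ((i : ℕ) : ZMod N)) h fun i => rfl]
    exact Fin.sum_univ_eq_sum_range (fun v => h ((v : ℕ) : ZMod N)) N
  -- (ii) the zero difference: `‖Σ_j w_j‖ ≤ 2M·s₀`
  have hzero : h ((0 : ℕ) : ZMod N) ≤ 2 * M * s₀ := by
    simp only [hh]
    have hd0 : (fun _ : Fin 1 => (((0 : ℕ) : ℕ) : ZMod N)) = 0 := by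
      funext i
      simp
    rw [hd0]
    simp only [torusChar_zero_right, mul_one]
    calc ‖∑ j : Fin (2 * M), w j‖ ≤ ∑ j : Fin (2 * M), ‖w j‖ := norm_sum_le _ _
      _ ≤ ∑ j : Fin (2 * M), s₀ := Finset.sum_le_sum fun j _ => hs j
      _ = 2 * M * s₀ := by rw [Finset.sum_const, Finset.card_univ, Fintype.card_fin, nsmul_eq_mul]; push_cast; ring
  -- (iii) the nonzero differences
  have hV : ∑ m ∈ Finset.range (2 * M + 2), ‖w m - 2 * w (m - 1) + w (m - 2)‖ ≤ (2 * M + 2) * v₂ := by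
    calc ∑ m ∈ Finset.range (2 * M + 2), ‖w m - 2 * w (m - 1) + w (m - 2)‖ ≤ ∑ m ∈ Finset.range (2 * M + 2), v₂ :=
          Finset.sum_le_sum fun m _ => hv m
      _ = (2 * M + 2) * v₂ := by rw [Finset.sum_const, Finset.card_range, nsmul_eq_mul]; push_cast; ring
  have hpt : ∀ v ∈ Finset.Ico 1 N, h ((v : ℕ) : ZMod N) ≤
      (2 * M + 2) * v₂ * (M : ℝ) ^ 2 * ((((v : ℕ) : ℝ) ^ 2)⁻¹ + (((N - v : ℕ) : ℝ) ^ 2)⁻¹) := fun v hvI => by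
    rw [Finset.mem_Ico] at hvI
    exact norm_weightedCharSum_le_of_ne_zero M w hw0 hw2M hV hvI.1 hvI.2
  -- (iv) `Σ_{1 ≤ v < N} (1/v² + 1/(N−v)²) ≤ 4`
  have hinv : ∑ v ∈ Finset.Ico 1 N, ((((v : ℕ) : ℝ) ^ 2)⁻¹ + (((N - v : ℕ) : ℝ) ^ 2)⁻¹) ≤ 4 := by
    have hIoo : Finset.Ico 1 N = Finset.Ioo 0 N := by
      ext v
      simp only [Finset.mem_Ico, Finset.mem_Ioo]
      omega
    have h2 : ∑ v ∈ Finset.Ico 1 N, (((v : ℕ) : ℝ) ^ 2)⁻¹ ≤ 2 := by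
      rw [hIoo]
      have h0 := sum_Ioo_inv_sq_le (α := ℝ) 0 N
      norm_num at h0
      exact h0
    have hrefl : ∑ v ∈ Finset.Ico 1 N, (((N - v : ℕ) : ℝ) ^ 2)⁻¹ = ∑ v ∈ Finset.Ico 1 N, (((v : ℕ) : ℝ) ^ 2)⁻¹ := by
      have h0 := Finset.sum_Ico_reflect (fun j : ℕ => (((j : ℕ) : ℝ) ^ 2)⁻¹) 1 (m := N) (n := N) (by omega)
      simp only [show N + 1 - N = 1 by omega, show N + 1 - 1 = N by omega] at h0
      exact h0
    rw [Finset.sum_add_distrib, hrefl]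
    linarith
  -- (v) assemble
  have hsplit : ∑ v ∈ Finset.range N, h ((v : ℕ) : ZMod N) = h ((0 : ℕ) : ZMod N) + ∑ v ∈ Finset.Ico 1 N, h ((v : ℕ) : ZMod N) :=
    Finset.sum_range_eq_add_Ico _ hNpos
  have hv₂0 : 0 ≤ v₂ := le_trans (norm_nonneg _) (hv 0)
  have htail : ∑ v ∈ Finset.Ico 1 N, h ((v : ℕ) : ZMod N) ≤ (2 * M + 2) * v₂ * (M : ℝ) ^ 2 * 4 := by
    calc ∑ v ∈ Finset.Ico 1 N, h ((v : ℕ) : ZMod N)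
        ≤ ∑ v ∈ Finset.Ico 1 N, (2 * M + 2) * v₂ * (M : ℝ) ^ 2 * ((((v : ℕ) : ℝ) ^ 2)⁻¹ + (((N - v : ℕ) : ℝ) ^ 2)⁻¹) :=
          Finset.sum_le_sum hpt
      _ = (2 * M + 2) * v₂ * (M : ℝ) ^ 2 * ∑ v ∈ Finset.Ico 1 N, ((((v : ℕ) : ℝ) ^ 2)⁻¹ + (((N - v : ℕ) : ℝ) ^ 2)⁻¹) := by
          rw [Finset.mul_sum]
      _ ≤ (2 * M + 2) * v₂ * (M : ℝ) ^ 2 * 4 := mul_le_mul_of_nonneg_left hinv (by positivity)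
  rw [hequiv, hrange, hsplit]
  have hfin : 1 / (2 * (M : ℝ)) * (2 * M * s₀ + (2 * M + 2) * v₂ * (M : ℝ) ^ 2 * 4) = s₀ + 4 * M * (M + 1) * v₂ := by
    field_simp
  calc 1 / (2 * (M : ℝ)) * (h ((0 : ℕ) : ZMod N) + ∑ v ∈ Finset.Ico 1 N, h ((v : ℕ) : ZMod N))
      ≤ 1 / (2 * (M : ℝ)) * (2 * M * s₀ + (2 * M + 2) * v₂ * (M : ℝ) ^ 2 * 4) :=
        mul_le_mul_of_nonneg_left (add_le_add hzero htail) (by positivity)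
    _ = s₀ + 4 * M * (M + 1) * v₂ := hfin

end Summit.HubbardSuperconductivity.HubbardSuperconductivity.Theorems.TwoVolumeSource

end
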